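import Summits.QuantumAdvantage.AdviceFreeQNC0.CodegOne
import Summits.QuantumAdvantage.AdviceFreeQNC0.DegreeBridge
import HarnessLib

/-!
# THEOREM E2, first step: a light coset leader with zero parity and zero point sums is a `2`-FLAT
# (qn-p2 ROUND-5 §2: "x ∈ A∖0: light rep a with |a| ∈ {2,4} even and Σa = 0: |a| = 2 impossible,
#  |a| = 4 with zero sum ⟺ a is an affine 2-flat")

Cell qa-qnc0 (route `QuantumAdvantage/RingFrame`, crux α = stmt-QuantumAdvantage-19119, tensor line), seat qa-qnc0-lit gen 10
— a worked instance of how the E2 kit composes (HOME/qa-qnc0-lit/E2-KIT.md): the `(ε,σ)`-invariants are `Syndrome.syn`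
(`CodegOne.lean`), the kernel of `syn` is `RM(m−2, m)` (`Syndrome.ker_eq_lowDeg`), and a non-zero word of `RM(m−2,m)` of
weight `< 6 = 1.5·d_min` is a minimum-weight word, i.e. a `2`-flat (Kasami–Tokura gap + MacWilliams–Sloane Ch. 13 Thm 8,
through `support_flat_of_lt_three_halves` of `DegreeBridge.lean`).

* `flat_of_syn_eq_zero` — on `m = d + 3` bits: a Boolean `a ≠ 0` with `syn [a] = 0` (even weight, all point sums zero) and
  `#supp a < 6` has `#supp a = 4` and `supp a = x₀ ⊕ V₀` for the `⊕`-closed period group `V₀ ∋ 0`, `#V₀ = 4` — a `2`-flat.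

WHAT THIS IS NOT: not E2; no statement about α; separation NOT moved.
-/

namespace Summit.QuantumAdvantage.AdviceFreeQNC0

open Finset
open Literature.Computability.MetaComplexity Literature.Computability.MetaComplexity.Smolensky
open Literature.Computability.QuantumComplexity.BuzetChailloux (bxor zeroVec)

/-- **Light words with vanishing moments of order `≤ 1` are `2`-flats** (E2, top-layer representation): on `m = d+3`
bits, if the indicator of `a` lies in the kernel of `Syndrome.syn` (zero parity, zero point sums), `a ≠ 0` and
`#supp a < 6`, then `#supp a = 4` and `supp a` is a coset `x₀ ⊕ V₀` of its `⊕`-closed period group `V₀` (`#V₀ = 4`). -/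
theorem flat_of_syn_eq_zero {d : ℕ} (a : (Fin (d + 3) → Bool) → Bool)
    (hsyn : Syndrome.syn (fun v => if a v = true then (1 : ZMod 2) else 0) = 0) (hne : ∃ v, a v = true)
    (hlt : #(univ.filter fun v => a v = true) < 6) :
    #(univ.filter fun v => a v = true) = 4 ∧
    zeroVec ∈ (univ.filter fun t : Fin (d + 3) → Bool => ∀ x, a (bxor x t) = a x) ∧
    (∀ s ∈ (univ.filter fun t : Fin (d + 3) → Bool => ∀ x, a (bxor x t) = a x),
      ∀ t ∈ (univ.filter fun t : Fin (d + 3) → Bool => ∀ x, a (bxor x t) = a x),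
        bxor s t ∈ (univ.filter fun t : Fin (d + 3) → Bool => ∀ x, a (bxor x t) = a x)) ∧
    #(univ.filter fun t : Fin (d + 3) → Bool => ∀ x, a (bxor x t) = a x) = 4 ∧
    ∀ x₀, a x₀ = true → (univ.filter fun v => a v = true) =
      (univ.filter fun t : Fin (d + 3) → Bool => ∀ x, a (bxor x t) = a x).image (bxor x₀) := by
  -- `a ∈ RM(d+1, d+3)`: the kernel of `syn` on `d + 3 = (d+1) + 2` bits is `lowDeg (d+1)`
  have hdeg : HasDeg a (d + 1) := by
    show (fun v => if a v = true then (1 : ZMod 2) else 0) ∈ lowDeg (ZMod 2) (d + 3) (d + 1)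
    have hker : (fun v => if a v = true then (1 : ZMod 2) else 0) ∈
        LinearMap.ker (Syndrome.syn (m := d + 1 + 2)) := LinearMap.mem_ker.2 hsyn
    rw [Syndrome.ker_eq_lowDeg (d + 1)] at hker
    exact hker
  -- Kasami–Tokura below `1.5·d_min` + minimum-weight words are flats
  have hlt' : 2 ^ (d + 1 + 1) * #(univ.filter fun v => a v = true) < 3 * 2 ^ (d + 3) := by
    have : 2 ^ (d + 1 + 1) * #(univ.filter fun v => a v = true) < 2 ^ (d + 1 + 1) * 6 :=
      Nat.mul_lt_mul_of_pos_left hlt (Nat.two_pow_pos _)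
    calc _ < 2 ^ (d + 1 + 1) * 6 := this
      _ = 3 * 2 ^ (d + 3) := by ring
  obtain ⟨hw, h0, hadd, hcard, hcoset⟩ := support_flat_of_lt_three_halves (Nat.succ_pos d) a hdeg hne hlt'
  have h4 : #(univ.filter fun v => a v = true) = 4 := by
    have h := hw
    rw [show 2 ^ (d + 3) = 2 ^ (d + 1) * 4 by ring] at h
    exact Nat.eq_of_mul_eq_mul_left (Nat.two_pow_pos _) h
  exact ⟨h4, h0, hadd, hcard.trans h4, hcoset⟩

end Summit.QuantumAdvantage.AdviceFreeQNC0
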